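import Literature.AlgebraicGeometry.Modules.LinearOverBase
import Mathlib.CategoryTheory.Abelian.FunctorCategory
import Mathlib.CategoryTheory.Limits.Preserves.Shapes.Kernels
import Mathlib.CategoryTheory.Limits.FunctorCategory.Basic

/-!
# Quasi-inverses of isogenies and the "roof" of the push–pull comparison (Stacks 088B)

In the proof of Grothendieck's existence theorem for a PROPER morphism (The Stacks Project,
Tag 088B "push–pull of inverse systems" and Tag 088C; Görtz–Wedhorn, *Algebraic Geometry II*
(2023), Construction 24.104 (3) and Lemma 24.105) a coherent formal module `𝓕 = (𝓕_n)_n` on `X`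
is compared with the completion `H^ = (H/aⁿ⁺¹H)_n` of the direct image `H = π_*𝒢'` of the
algebraization `𝒢'` of `π^*𝓕` on a Chow cover `π : X' → X`. The two natural maps point INTO the
common target `P_n = π_*(𝒢'/aⁿ⁺¹𝒢')`:

  `𝓕_n —u_n→ π_*π^*𝓕_n ≅ P_n ←v_n— H/aⁿ⁺¹H`,

and neither is invertible; but (theorem on formal functions in degree `0`, Tags 02OB/02OC) `v_n`
has kernel and cokernel killed by a FIXED power `aᶜ`, and over a birational cover of a normal
scheme `u_n` is a monomorphism with cokernel killed by a fixed power `aᶜ'`. This file supplies the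
elementary homological algebra turning such a roof into an honest morphism of towers
`α : 𝓕 → H^` with kernels and cokernels killed by a fixed power of `a`:

* `exists_quasiInverse_of_torsion_kernel_cokernel` — in an abelian category with a central family
  of endomorphisms `ε`, a morphism `v : A → B` whose kernel and cokernel are killed by `ε` admits
  `w : B → A` with `v ≫ w = ε²` and `w ≫ v = ε²` (through the coimage–image factorisation);
* `exists_hom_of_roof` — hence for a monomorphism `u : F → B` with cokernel killed by `ε'`, the
  composite `α = u ≫ w : F → A` has kernel killed by `ε²` and cokernel killed by `ε'ε²`;
* `exists_towerHom_of_powTorsion_roof` — the same for TOWERS `ℕᵒᵖ ⥤ Mod(𝒪_X)` and the central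
  endomorphisms "multiplication by a power of a global function `a`" (`globalScalar`), levelwise
  hypotheses and levelwise conclusions, the morphism `α` being a morphism of towers (the lemma is
  applied in the abelian functor category, where kernels and cokernels are computed levelwise).

Everything is proved; no named facts; no definitions.

## References

* The Stacks Project, Tag 088B (Cohomology of Schemes, Lemma 30.27.2), Tag 088C, Tag 02OC.
  [StacksProject]
* U. Görtz, T. Wedhorn, *Algebraic Geometry II: Cohomology of Schemes*, Springer Spektrum (2023),
  doi:10.1007/978-3-658-43031-3: Construction 24.104 (3), Lemma 24.105 (pp. 571–573).
  [GortzWedhorn2023]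
-/

noncomputable section

open CategoryTheory CategoryTheory.Limits

universe v u w

namespace Literature.AlgebraicGeometry.Morphisms

/-! ### Quasi-inverses in an abelian category -/

section Abelian

variable {C : Type u} [Category.{v} C] [Abelian C]
  (ε : ∀ Z : C, Z ⟶ Z) (hε : ∀ {Z Z' : C} (f : Z ⟶ Z'), ε Z ≫ f = f ≫ ε Z')

include hε in
/-- **A morphism whose kernel and cokernel are killed by a central endomorphism `ε` is invertible
up to `ε²`**: there is `w : B → A` with `v ≫ w = ε²` and `w ≫ v = ε²`. Construction:
`B —ε→ B` factors through `im v` (its composite with `B → coker v` vanishes), `im v ≅ coim v`, and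
`A —ε→ A` factors through `A → coim v` (it kills `ker v`). The torsion hypotheses are stated on
generalized elements. [cite: StacksProject, Tag 088B] -/
theorem exists_quasiInverse_of_torsion_kernel_cokernel {A B : C} (v : A ⟶ B)
    (hk : ∀ {T : C} (z : T ⟶ A), z ≫ v = 0 → z ≫ ε A = 0)
    (hc : ∀ {T : C} (q : B ⟶ T), v ≫ q = 0 → ε B ≫ q = 0) :
    ∃ w : B ⟶ A, v ≫ w = ε A ≫ ε A ∧ w ≫ v = ε B ≫ ε B := by
  -- `ε_B` factors through the image, `ε_A` through the coimage
  let m : B ⟶ Abelian.image v := kernel.lift (cokernel.π v) (ε B) (hc _ (cokernel.condition v))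
  have hm : m ≫ Abelian.image.ι v = ε B := kernel.lift_ι _ _ _
  let δ : Abelian.coimage v ⟶ A := cokernel.desc (kernel.ι v) (ε A) (hk _ (kernel.condition v))
  have hδ : Abelian.coimage.π v ≫ δ = ε A := cokernel.π_desc _ _ _
  have hfac := Abelian.coimage_image_factorisation v
  refine ⟨m ≫ inv (Abelian.coimageImageComparison v) ≫ δ, ?_, ?_⟩
  · -- `v ≫ m = ε_A ≫ coim.π ≫ comparison` (check after the monomorphism `image.ι`)
    have h1 : v ≫ m = ε A ≫ Abelian.coimage.π v ≫ Abelian.coimageImageComparison v := by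
      rw [← cancel_mono (Abelian.image.ι v)]
      simp only [Category.assoc]
      rw [hm, hfac, hε]
    rw [reassoc_of% h1, IsIso.hom_inv_id_assoc, hδ]
  · -- `δ ≫ v = comparison ≫ image.ι ≫ ε_B` (check after the epimorphism `coimage.π`)
    have h2 : δ ≫ v = Abelian.coimageImageComparison v ≫ Abelian.image.ι v ≫ ε B := by
      rw [← cancel_epi (Abelian.coimage.π v), reassoc_of% hδ, hε, reassoc_of% hfac]
    rw [Category.assoc, Category.assoc, h2, IsIso.inv_hom_id_assoc, reassoc_of% hm]

include hε in
/-- **The roof.** Let `u : F → B` be a monomorphism whose cokernel is killed by a central `ε'`,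
and `v : A → B` a morphism whose kernel and cokernel are killed by a central `ε`. Then there is
`α : F → A` (namely `u` followed by a quasi-inverse of `v`) whose kernel is killed by `ε²` and whose
cokernel is killed by `ε'ε²` (generalized-element form). [cite: StacksProject, Tag 088B] -/
theorem exists_hom_of_roof (ε' : ∀ Z : C, Z ⟶ Z) (hε' : ∀ {Z Z' : C} (f : Z ⟶ Z'), ε' Z ≫ f = f ≫ ε' Z')
    {F A B : C} (u : F ⟶ B) [Mono u] (v : A ⟶ B)
    (hu : ∀ {T : C} (q : B ⟶ T), u ≫ q = 0 → ε' B ≫ q = 0)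
    (hk : ∀ {T : C} (z : T ⟶ A), z ≫ v = 0 → z ≫ ε A = 0)
    (hc : ∀ {T : C} (q : B ⟶ T), v ≫ q = 0 → ε B ≫ q = 0) :
    ∃ α : F ⟶ A, (∀ {T : C} (z : T ⟶ F), z ≫ α = 0 → z ≫ ε F ≫ ε F = 0) ∧
      ∀ {T : C} (q : A ⟶ T), α ≫ q = 0 → ε' A ≫ ε A ≫ ε A ≫ q = 0 := by
  obtain ⟨w, hvw, hwv⟩ := exists_quasiInverse_of_torsion_kernel_cokernel ε hε v hk hc
  refine ⟨u ≫ w, fun z hz => ?_, fun q hq => ?_⟩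
  · -- `z ≫ ε² ≫ u = z ≫ u ≫ ε² = z ≫ u ≫ w ≫ v = 0`
    have hz' : z ≫ u ≫ w = 0 := by simpa only [Category.assoc] using hz
    rw [← cancel_mono u]
    simp only [Category.assoc, zero_comp]
    rw [hε u, reassoc_of% (hε u), ← hwv, reassoc_of% hz', zero_comp]
  · -- `ε' ≫ ε² ≫ q = ε' ≫ v ≫ w ≫ q = v ≫ ε'_B ≫ w ≫ q`, and `ε'_B` factors through `u`
    let μ : B ⟶ F := Abelian.monoLift u (ε' B) (hu _ (cokernel.condition u))
    have hμ : μ ≫ u = ε' B := Abelian.monoLift_comp _ _ _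
    have hq' : u ≫ w ≫ q = 0 := by simpa only [Category.assoc] using hq
    rw [← reassoc_of% hvw, reassoc_of% (hε' v), ← hμ]
    simp only [Category.assoc]
    rw [hq', comp_zero, comp_zero]

end Abelian

/-! ### Towers of `𝒪_X`-modules: levelwise hypotheses, levelwise conclusions -/

section Towers

open _root_.AlgebraicGeometry Literature.AlgebraicGeometry.Modules

variable {X : Scheme.{w}} (b : Γ(X, ⊤))

/-- Multiplication by `b` on every level of a tower is a morphism of towers. [folklore] -/
private theorem globalScalar_naturality (T : ℕᵒᵖ ⥤ X.Modules) {k k' : ℕᵒᵖ} (g : k ⟶ k') :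
    T.map g ≫ globalScalar (T.obj k') b = globalScalar (T.obj k) b ≫ T.map g :=
  (globalScalar_comp (T.map g) b).symm

/-- **The roof for towers of `𝒪_X`-modules.** Let `u : 𝓕 → P` and `v : 𝓗 → P` be morphisms of
towers `ℕᵒᵖ ⥤ Mod(𝒪_X)` and `b` a global function such that, levelwise, `u_n` is a monomorphism
with cokernel killed by `b^c'`, and `v_n` has kernel and cokernel killed by `bᶜ`. Then there is a
morphism of towers `α : 𝓕 → 𝓗` whose levelwise kernels are killed by `b²ᶜ` and cokernels by
`b^(2c+c')`. (Apply `exists_hom_of_roof` in the abelian functor category `ℕᵒᵖ ⥤ Mod(𝒪_X)`, where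
kernels and cokernels are computed levelwise.) [cite: StacksProject, Tag 088B]
[cite: GortzWedhorn2023, Construction 24.104 (3) and Lemma 24.105 (pp. 571–573)] -/
theorem exists_towerHom_of_powTorsion_roof {𝓕 P 𝓗 : ℕᵒᵖ ⥤ X.Modules} (u : 𝓕 ⟶ P) (v : 𝓗 ⟶ P)
    {c c' : ℕ} (hu : ∀ n, Mono (u.app n))
    (huc : ∀ n, globalScalar (P.obj n) (b ^ c') ≫ cokernel.π (u.app n) = 0)
    (hvk : ∀ n, kernel.ι (v.app n) ≫ globalScalar (𝓗.obj n) (b ^ c) = 0)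
    (hvc : ∀ n, globalScalar (P.obj n) (b ^ c) ≫ cokernel.π (v.app n) = 0) :
    ∃ α : 𝓕 ⟶ 𝓗, ∀ n, kernel.ι (α.app n) ≫ globalScalar (𝓕.obj n) (b ^ (c + c)) = 0 ∧
      globalScalar (𝓗.obj n) (b ^ (c + c + c')) ≫ cokernel.π (α.app n) = 0 := by
  -- the central endomorphisms "multiplication by `bᶜ`", "by `b^c'`" of the functor category
  let ε : ∀ T : ℕᵒᵖ ⥤ X.Modules, T ⟶ T := fun T =>
    { app := fun k => globalScalar (T.obj k) (b ^ c)
      naturality := fun _ _ g => globalScalar_naturality _ T g }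
  let ε' : ∀ T : ℕᵒᵖ ⥤ X.Modules, T ⟶ T := fun T =>
    { app := fun k => globalScalar (T.obj k) (b ^ c')
      naturality := fun _ _ g => globalScalar_naturality _ T g }
  have hε : ∀ {T T' : ℕᵒᵖ ⥤ X.Modules} (f : T ⟶ T'), ε T ≫ f = f ≫ ε T' := fun f =>
    NatTrans.ext (funext fun k => globalScalar_comp (f.app k) _)
  have hε' : ∀ {T T' : ℕᵒᵖ ⥤ X.Modules} (f : T ⟶ T'), ε' T ≫ f = f ≫ ε' T' := fun f =>
    NatTrans.ext (funext fun k => globalScalar_comp (f.app k) _)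
  haveI : ∀ k, Mono (u.app k) := hu
  haveI : Mono u := NatTrans.mono_of_mono_app u
  -- levelwise hypotheses ⇒ generalized-element hypotheses in the functor category
  have hu' : ∀ {T : ℕᵒᵖ ⥤ X.Modules} (q : P ⟶ T), u ≫ q = 0 → ε' P ≫ q = 0 := by
    intro T q hq
    refine NatTrans.ext (funext fun k => ?_)
    have hqk : u.app k ≫ q.app k = 0 := by rw [← NatTrans.comp_app, hq, NatTrans.app_zero]
    rw [NatTrans.comp_app, NatTrans.app_zero]
    change globalScalar (P.obj k) (b ^ c') ≫ q.app k = 0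
    rw [← cokernel.π_desc (u.app k) (q.app k) hqk, reassoc_of% (huc k), zero_comp]
  have hk' : ∀ {T : ℕᵒᵖ ⥤ X.Modules} (z : T ⟶ 𝓗), z ≫ v = 0 → z ≫ ε 𝓗 = 0 := by
    intro T z hz
    refine NatTrans.ext (funext fun k => ?_)
    have hzk : z.app k ≫ v.app k = 0 := by rw [← NatTrans.comp_app, hz, NatTrans.app_zero]
    rw [NatTrans.comp_app, NatTrans.app_zero]
    change z.app k ≫ globalScalar (𝓗.obj k) (b ^ c) = 0
    rw [← kernel.lift_ι (v.app k) (z.app k) hzk, Category.assoc, hvk k, comp_zero]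
  have hc' : ∀ {T : ℕᵒᵖ ⥤ X.Modules} (q : P ⟶ T), v ≫ q = 0 → ε P ≫ q = 0 := by
    intro T q hq
    refine NatTrans.ext (funext fun k => ?_)
    have hqk : v.app k ≫ q.app k = 0 := by rw [← NatTrans.comp_app, hq, NatTrans.app_zero]
    rw [NatTrans.comp_app, NatTrans.app_zero]
    change globalScalar (P.obj k) (b ^ c) ≫ q.app k = 0
    rw [← cokernel.π_desc (v.app k) (q.app k) hqk, reassoc_of% (hvc k), zero_comp]
  obtain ⟨α, hαk, hαc⟩ := exists_hom_of_roof ε hε ε' hε' u v hu' hk' hc'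
  refine ⟨α, fun k => ⟨?_, ?_⟩⟩
  · -- the kernel of `α_k` maps to the level `k` of the kernel of `α`
    let G := (evaluation ℕᵒᵖ X.Modules).obj k
    have hlim : IsLimit ((KernelFork.ofι (kernel.ι α) (kernel.condition α)).map G) :=
      KernelFork.mapIsLimit _ (kernelIsKernel α) G
    let l : kernel (α.app k) ⟶ (kernel α).obj k :=
      hlim.lift (KernelFork.ofι (kernel.ι (α.app k)) (kernel.condition (α.app k)))
    have hl : l ≫ (kernel.ι α).app k = kernel.ι (α.app k) :=
      hlim.fac (KernelFork.ofι (kernel.ι (α.app k)) (kernel.condition (α.app k)))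
        WalkingParallelPair.zero
    have h := congr_app (hαk (kernel.ι α) (kernel.condition α)) k
    rw [NatTrans.comp_app, NatTrans.comp_app, NatTrans.app_zero] at h
    change (kernel.ι α).app k ≫ globalScalar (𝓕.obj k) (b ^ c) ≫ globalScalar (𝓕.obj k) (b ^ c) = 0
      at h
    rw [← hl, Category.assoc, pow_add, globalScalar_mul, h, comp_zero]
  · -- the level `k` of the cokernel of `α` maps to the cokernel of `α_k`
    let G := (evaluation ℕᵒᵖ X.Modules).obj k
    have hcolim : IsColimit ((CokernelCofork.ofπ (cokernel.π α) (cokernel.condition α)).map G) :=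
      CokernelCofork.mapIsColimit _ (cokernelIsCokernel α) G
    let l : (cokernel α).obj k ⟶ cokernel (α.app k) :=
      hcolim.desc (CokernelCofork.ofπ (cokernel.π (α.app k)) (cokernel.condition (α.app k)))
    have hl : (cokernel.π α).app k ≫ l = cokernel.π (α.app k) :=
      hcolim.fac (CokernelCofork.ofπ (cokernel.π (α.app k)) (cokernel.condition (α.app k)))
        WalkingParallelPair.one
    have h := congr_app (hαc (cokernel.π α) (cokernel.condition α)) k
    rw [NatTrans.comp_app, NatTrans.comp_app, NatTrans.comp_app, NatTrans.app_zero] at h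
    change globalScalar (𝓗.obj k) (b ^ c') ≫ globalScalar (𝓗.obj k) (b ^ c) ≫
      globalScalar (𝓗.obj k) (b ^ c) ≫ (cokernel.π α).app k = 0 at h
    rw [← hl, pow_add, globalScalar_mul, pow_add, globalScalar_mul, Category.assoc, Category.assoc,
      reassoc_of% h, zero_comp]

end Towers

end Literature.AlgebraicGeometry.Morphisms

end
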